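import Literature.Dynamics.NBody.AlbouyKaloshin2012Eliminants
import Mathlib.Algebra.Polynomial.AlgebraMap

/-!
# Rational eliminants (the shape of a computer-algebra certificate over `ℚ`)

Topic `Literature/Dynamics/NBody`; `pub-smale6` cell, seat 1 gen 3.  Companion to `AlbouyKaloshin2012Eliminants.lean`: the slice systems have
rational coefficients, so an exact Gröbner / rational-univariate-representation computation (msolve, Singular) delivers univariate eliminants in
`ℚ[X]`.  `eliminants_of_rat` maps such a rational eliminant to the complex one required by `finite_of_coordRoots` (injectivity of `ℚ → ℂ`), and
`roberts4441_reflSymmCCs_finite_of_rat_eliminants` / `reflSymmCCs_223_finite_of_rat_eliminants` restate the two capstones with hypotheses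
"for every coordinate `i` a nonzero `g ∈ ℚ[X]` with `aeval (X.coords i) g = 0` for every complex solution `X`".  No eliminant is exhibited
(the cell's evidence that they exist is modular: `certs/modgb/`).  Elementary; [folklore].
-/

namespace Literature.Dynamics.NBody
open Polynomial

/-- Rational eliminants suffice: a nonzero `g ∈ ℚ[X]` with `aeval z g = 0` gives the nonzero complex eliminant `g.map (algebraMap ℚ ℂ)`. [folklore] -/
theorem eliminants_of_rat {α ι : Type*} (S : Set α) (π : α → ι → ℂ)
    (h : ∀ i, ∃ g : ℚ[X], g ≠ 0 ∧ ∀ x ∈ S, aeval (π x i) g = 0) :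
    ∀ i, ∃ f : ℂ[X], f ≠ 0 ∧ ∀ x ∈ S, f.IsRoot (π x i) := by
  intro i
  obtain ⟨g, hg0, hg⟩ := h i
  refine ⟨g.map (algebraMap ℚ ℂ), ?_, ?_⟩
  · exact (Polynomial.map_ne_zero_iff (algebraMap ℚ ℂ).injective).2 hg0
  · intro x hx
    rw [IsRoot, eval_map, ← aeval_def]
    exact hg x hx

/-- Roberts capstone with RATIONAL eliminants (the shape a computer-algebra certificate over `ℚ` delivers). [cite: AlbouyKaloshin2012, Remark 8 p. 583] -/
theorem roberts4441_reflSymmCCs_finite_of_rat_eliminants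
    (hA : ∀ i : Fin 12, ∃ g : ℚ[X], g ≠ 0 ∧ ∀ X ∈ t12BranchSetC 1 1 1 1 1 (1 / 4), aeval (X.coords i) g = 0)
    (hB : ∀ i : Fin 12, ∃ g : ℚ[X], g ≠ 0 ∧ ∀ X ∈ t12BranchSetC 1 1 1 (-1) 1 (1 / 4), aeval (X.coords i) g = 0)
    (hC : ∀ i : Fin 11, ∃ g : ℚ[X], g ≠ 0 ∧ ∀ X ∈ t1234BranchSetC 1 1 1 (1 / 4), aeval (X.coords i) g = 0) :
    (reflSymmCCs ![4, 4, 4, 4, 1]).Finite :=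
  roberts4441_reflSymmCCs_finite_of_eliminants (eliminants_of_rat _ T12PtC.coords hA)
    (eliminants_of_rat _ T12PtC.coords hB) (eliminants_of_rat _ T1234PtC.coords hC)

/-- Generic-point capstone with rational eliminants. [cite: AlbouyKaloshin2012, Remark 8 p. 583] -/
theorem reflSymmCCs_223_finite_of_rat_eliminants
    (hA : ∀ i : Fin 12, ∃ g : ℚ[X], g ≠ 0 ∧ ∀ X ∈ t12BranchSetC 1 1 1 1 2 3, aeval (X.coords i) g = 0)
    (hB : ∀ i : Fin 12, ∃ g : ℚ[X], g ≠ 0 ∧ ∀ X ∈ t12BranchSetC 1 1 1 (-1) 2 3, aeval (X.coords i) g = 0)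
    (hA' : ∀ i : Fin 12, ∃ g : ℚ[X], g ≠ 0 ∧ ∀ X ∈ t12BranchSetC 1 1 1 1 (1 / 2) (3 / 2), aeval (X.coords i) g = 0)
    (hB' : ∀ i : Fin 12, ∃ g : ℚ[X], g ≠ 0 ∧ ∀ X ∈ t12BranchSetC 1 1 1 (-1) (1 / 2) (3 / 2), aeval (X.coords i) g = 0)
    (hC : ∀ i : Fin 11, ∃ g : ℚ[X], g ≠ 0 ∧ ∀ X ∈ t1234BranchSetC 1 1 2 3, aeval (X.coords i) g = 0) :
    (reflSymmCCs (e32Masses 2 3)).Finite :=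
  reflSymmCCs_223_finite_of_eliminants (eliminants_of_rat _ T12PtC.coords hA) (eliminants_of_rat _ T12PtC.coords hB)
    (eliminants_of_rat _ T12PtC.coords hA') (eliminants_of_rat _ T12PtC.coords hB') (eliminants_of_rat _ T1234PtC.coords hC)

end Literature.Dynamics.NBody
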